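import Summits.BirchSwinnertonDyer.BirchSwinnertonDyer.Theorems.ResidualThetaTransportAtTwoSignedMuSeedAtTwoPlusLayerZero
import Summits.BirchSwinnertonDyer.BirchSwinnertonDyer.Theorems.ThetaPartnerAtTwoSignedControlAtTwoStubPlusHondaSystemTwo
import Summits.BirchSwinnertonDyer.BirchSwinnertonDyer.Theorems.ThetaPartnerAtTwoSignedControlAtTwoPlusHondaTransportNonDiv
import Summits.BirchSwinnertonDyer.BirchSwinnertonDyer.Theorems.ThetaPartnerAtTwoSignedControlAtTwoPlusLocalInjOfHonda
import Summits.BirchSwinnertonDyer.BirchSwinnertonDyer.Theorems.ThetaPartnerAtTwoSignedControlAtTwoLocalNonDivTwo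
import HarnessLib

/-!
# Seed crux `SignedMuSeedAtTwoPlus` (stmt-BirchSwinnertonDyer-21438): EXACT CONTROL AT LAYER 0 for `Sel⁺` at `2`,
# UNCONDITIONAL — `#Sel⁺(A/ℚ_∞)^γ = #Sel_{2^∞}(A/ℚ)` for a good-supersingular-at-2, `a₂ = 0` curve with odd Tamagawa
# product and finite `Sel_{2^∞}(A/ℚ)`; hence the layer-`1` count of the residual certificate IS the `2`-descent count

Cell `bsd-wall`, width seat `bsd-wall-rtt-p4-w3` (g3). THEOREMS ONLY (no `def`, no named fact, no `sorry`); helper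
`--supports` the seed crux (= `stub_residualSeedAtTwo` of line `birth` of Kμ⁺ stmt-BirchSwinnertonDyer-20689); nothing about any
particular curve is asserted; BSD is not proved by this. Route-independent imports.

Two one-sided results of the tree, now both unconditional, meet:
* UPPER (tp2-p3, Greenberg's Lemma 4.3 + localisation): `#(Sel⁺_∞)^γ · #A[2^∞]^{Γ_ℚ} ∣ #Sel_{2^∞}(A/ℚ) · 2^{ord₂ ∏c_ℓ}` under INJ⁺@2
  (`SignedEC.natCard_signedSelmerInvariants_mul_dvd_of_localInj`), where INJ⁺@2 ⟸ HONDA⁺@2 (`SignedEC.plusLocalInj_two_of_honda`) and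
  HONDA⁺@2 is a THEOREM for every globally minimal `A` with `GoodSS A 2`, `a₂(A) = 0` (tp2-p3-w2's `SignedEC.PlusLayer.plusHondaSystemTwo_padic`
  transported by tp2-p3-w3's `SignedEC.plusHondaSystem_adicCompletion_of_padic_nonDiv`), and `#A[2^∞]^{Γ_ℚ} = 1`;
* LOWER (this seat, `…LayerZero`): `h_0 : Sel_{2^∞}(A/ℚ) → (Sel⁺_∞)^γ` is injective.

* §1 `plusLocalInj_two` — INJ⁺@2 with no hypothesis beyond `GoodSS A 2`, `a₂(A) = 0` (assembly of the three theorems above).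
* §2 `natCard_selmer_le_natCard_endInvariants` (lower bound, whole group), `natCard_endInvariants_dvd` (upper divisibility),
  **`natCard_endInvariants_eq_natCard_selmer`**: `2 ∤ ∏c_ℓ(A)` ⟹ `#(Sel⁺(A/ℚ_∞))^γ = #Sel_{2^∞}(A/ℚ)` — Kobayashi's control
  theorem (Thm. 9.3) at `n = 0`, `p = 2`, in `Nat.card` form, for clean curves.
* §3 **`natCard_fixed_twoTorsion_eq_natCard_selmer_twoTorsion`**: for such `A`, the layer-`1` count of the residual certificate of
  `…LayerDual` is a `2`-DESCENT count: `#{s ∈ Sel⁺_∞ : 2s = 0, (γ−1)s = 0} = #Sel_{2^∞}(A/ℚ)[2]` (`h_0` is then a bijective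
  homomorphism onto `(Sel⁺_∞)^γ`). So the certificate «`#Sel⁺_∞[2,(γ−1)^b] < 2^{b−1} · #Sel_{2^∞}(A/ℚ)[2]`» for ONE `b ≥ 2` gives
  conj. 1 at a clean `A` — what remains per class is an UPPER bound on the layer-`b` count (control at a higher layer).

References: [Kobayashi2003] Thm. 9.3, Def. 1.1, §8.4; [GreenbergLNM1716] §3 Lemma 3.2, §4 Lemmas 4.3–4.4; [BDKim2013] proof of Cor. 3.15;
[KuriharaOtsuki2006] Rem. 0.2 (3).
-/

set_option autoImplicit false
set_option linter.dupNamespace false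

noncomputable section

open scoped Classical NumberField

open NumberField IsDedekindDomain WeierstrassCurve Literature.NumberTheory.EllipticCurves
  Literature.NumberTheory.EllipticCurves.IwasawaAlgebra Literature.NumberTheory.EllipticCurves.Kobayashi2003
  Literature.NumberTheory.EllipticCurves.Rank1Residual Literature.NumberTheory.EllipticCurves.IwasawaDual ZpExtension

namespace Summit.BirchSwinnertonDyer.BirchSwinnertonDyer.Theorems.SignedMuAtTwo.LayerZero

variable (A : WeierstrassCurve ℚ) [A.IsElliptic] [A.IsGloballyMinimal]

/-! ## §1. INJ⁺@2, unconditional -/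

/-- **INJ⁺@2 for every globally minimal `A/ℚ` with `GoodSS A 2`, `a₂(A) = 0`**: along the cyclotomic `ℤ₂`-extension, every class
of `A⁺_0 = h_0⁻¹(Sel⁺(A/ℚ_∞)) ⊆ H¹(ℚ, A[2^∞])` satisfies the classical local condition at the place above `2`. HONDA⁺@2
(`SignedEC.PlusLayer.plusHondaSystemTwo_padic`, every embedding) transported to `ℚ_v` (`SignedEC.plusHondaSystem_adicCompletion_of_padic_nonDiv`)
and fed to tp2-p3's `SignedEC.plusLocalInj_two_of_honda`. [cite: Kobayashi2003, §8.4 and Thm. 9.3] [cite: BDKim2013, proof of Cor. 3.15] -/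
theorem plusLocalInj_two (hss : GoodSS A 2) (ha : A.frobeniusTrace 2 = 0) {κ : ZpExtension ℚ 2} (hκ : κ.IsCyclotomic)
    (v : HeightOneSpectrum (𝓞 ℚ)) (hv : (2 : 𝓞 ℚ) ∈ v.asIdeal) :
    ∀ y ∈ (signedSelmerInfty A κ 1).comap (A.layerToInfty κ 0),
      A.localResOver 2 (κ.layerSubgroup 0) (v.adicCompletion ℚ) y = 0 := by
  obtain ⟨d, hd, htr, hgen, hgen0⟩ := SignedEC.plusHondaSystem_adicCompletion_of_padic_nonDiv A hss κ v hv
    fun ι ↦ SignedEC.PlusLayer.plusHondaSystemTwo_padic A hss ha κ hκ ι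
  exact SignedEC.plusLocalInj_two_of_honda A hss hκ v hv
    (SignedEC.exists_mem_localLayerPointsOfEmb_zero_ne_two_nsmul A κ v hv) d hd htr hgen hgen0

/-! ## §2. Exact control at layer `0` -/

/-- **Lower bound (whole group): `#Sel_{2^∞}(A/ℚ) ≤ #(Sel⁺(A/ℚ_∞))^γ`** when the right side is finite: the injective `h_0`
(`layerToInfty_zero_injective`) carries `Sel_{2^∞}(A/ℚ) ≅ Sel_{2^∞}(A/ℚ_0)` into the `γ`-fixed part of `Sel⁺_∞`.
[cite: GreenbergLNM1716, §3 Lemma 3.2 (p. 86)] [cite: Kobayashi2003, Def. 1.1] -/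
theorem natCard_selmer_le_natCard_endInvariants (hss : GoodSS A 2) (κ : ZpExtension ℚ 2) (γ : Field.absoluteGaloisGroup ℚ)
    [Finite (endInvariants (conjSignedSelmerInfty A κ 1 γ - 1))] :
    Nat.card (A.selmerGroupPInfty 2) ≤ Nat.card (endInvariants (conjSignedSelmerInfty A κ 1 γ - 1)) := by
  obtain ⟨e⟩ := A.nonempty_selmerLayer_zero_addEquiv κ (p := 2)
  have hmem : ∀ y : A.selmerLayer κ 0,
      A.layerToInfty κ 0 (y : A.subgroupH1 2 (κ.layerSubgroup 0)) ∈ signedSelmerInfty A κ 1 := fun y ↦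
    SignedEC.selmerLayer_zero_le_comap_layerToInfty_signedSelmerInfty A κ 1 y.2
  have hfix : ∀ y : A.selmerLayer κ 0,
      (⟨A.layerToInfty κ 0 (y : A.subgroupH1 2 (κ.layerSubgroup 0)), hmem y⟩ : signedSelmerInfty A κ 1) ∈
        endInvariants (conjSignedSelmerInfty A κ 1 γ - 1) := by
    intro y
    have hinv : A.layerToInfty κ 0 (y : A.subgroupH1 2 (κ.layerSubgroup 0)) ∈ A.layerInvariants κ 0 :=
      A.range_layerToInfty_le_layerInvariants_holds κ 0 ⟨_, rfl⟩
    exact (SignedEC.mem_endInvariants_conjSignedSelmerInfty_iff A κ 1 γ ⟨_, hmem y⟩).mpr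
      (A.conjH1_eq_of_mem_layerInvariants_zero κ γ hinv)
  let f : A.selmerGroupPInfty 2 → endInvariants (conjSignedSelmerInfty A κ 1 γ - 1) := fun c ↦
    ⟨⟨A.layerToInfty κ 0 (e.symm c : A.subgroupH1 2 (κ.layerSubgroup 0)), hmem _⟩, hfix _⟩
  have hf : Function.Injective f := by
    intro c c' h
    have h1 : A.layerToInfty κ 0 (e.symm c : A.subgroupH1 2 (κ.layerSubgroup 0)) =
        A.layerToInfty κ 0 (e.symm c' : A.subgroupH1 2 (κ.layerSubgroup 0)) :=
      congrArg (fun s : endInvariants (conjSignedSelmerInfty A κ 1 γ - 1) ↦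
        ((s.1 : signedSelmerInfty A κ 1) : A.subgroupH1 2 κ.kerSubgroup)) h
    exact e.symm.injective (Subtype.ext (layerToInfty_zero_injective A hss κ h1))
  exact Nat.card_le_card_of_injective f hf

/-- **Upper divisibility: `#(Sel⁺(A/ℚ_∞))^γ ∣ #Sel_{2^∞}(A/ℚ) · 2^{ord₂ ∏ c_ℓ(A)}`** (and `(Sel⁺_∞)^γ` is finite) for `A`
globally minimal with `GoodSS A 2`, `a₂(A) = 0`, `Sel_{2^∞}(A/ℚ)` finite, the cyclotomic `κ` and a topological generator `γ`:
tp2-p3's one-sided count with INJ⁺@2 discharged (§1) and `#A[2^∞]^{Γ_ℚ} = 1`. [cite: GreenbergLNM1716, §4 Lemmas 4.3–4.4]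
[cite: BDKim2013, proof of Cor. 3.15] [cite: Kobayashi2003, Thm. 9.3] -/
theorem natCard_endInvariants_dvd (hss : GoodSS A 2) (ha : A.frobeniusTrace 2 = 0) {κ : ZpExtension ℚ 2}
    (hκ : κ.IsCyclotomic) {γ : Field.absoluteGaloisGroup ℚ} (hγ : κ.IsTopGenerator γ) (hfin : Finite (A.selmerGroupPInfty 2)) :
    Finite (endInvariants (conjSignedSelmerInfty A κ 1 γ - 1)) ∧
      Nat.card (endInvariants (conjSignedSelmerInfty A κ 1 γ - 1)) ∣
        Nat.card (A.selmerGroupPInfty 2) * 2 ^ padicValNat 2 A.tamagawaProduct := by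
  obtain ⟨hfinI, hdvd⟩ := SignedEC.natCard_signedSelmerInvariants_mul_dvd_of_localInj A 2 1 hκ hγ
    (fun v hv ↦ plusLocalInj_two A hss ha hκ v hv) hfin
  rw [SignedEC.natCard_fixedPoints_geomPrimaryTorsion_two_eq_one A hss, mul_one] at hdvd
  exact ⟨hfinI, hdvd⟩

/-- **EXACT CONTROL AT LAYER 0: `#(Sel⁺(A/ℚ_∞))^γ = #Sel_{2^∞}(A/ℚ)`** for `A/ℚ` globally minimal, good supersingular at `2`
with `a₂(A) = 0`, `2 ∤ ∏ c_ℓ(A)` and `Sel_{2^∞}(A/ℚ)` finite, along the cyclotomic `ℤ₂`-extension with topological generator `γ`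
(`#(Sel⁺_∞)^γ ∣ #Sel` and `#Sel ≤ #(Sel⁺_∞)^γ`). Kobayashi's Theorem 9.3 at `n = 0` READ AT `p = 2`, unconditional in the tree.
[cite: Kobayashi2003, Thm. 9.3] [cite: GreenbergLNM1716, §4 Lemmas 4.3–4.4] [cite: KuriharaOtsuki2006, Rem. 0.2 (3)] -/
theorem natCard_endInvariants_eq_natCard_selmer (hss : GoodSS A 2) (ha : A.frobeniusTrace 2 = 0) {κ : ZpExtension ℚ 2}
    (hκ : κ.IsCyclotomic) {γ : Field.absoluteGaloisGroup ℚ} (hγ : κ.IsTopGenerator γ) (hfin : Finite (A.selmerGroupPInfty 2))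
    (hTam : ¬ 2 ∣ A.tamagawaProduct) :
    Nat.card (endInvariants (conjSignedSelmerInfty A κ 1 γ - 1)) = Nat.card (A.selmerGroupPInfty 2) := by
  obtain ⟨hfinI, hdvd⟩ := natCard_endInvariants_dvd A hss ha hκ hγ hfin
  rw [padicValNat.eq_zero_of_not_dvd hTam, pow_zero, mul_one] at hdvd
  haveI := hfinI
  haveI := hfin
  exact le_antisymm (Nat.le_of_dvd Nat.card_pos hdvd) (natCard_selmer_le_natCard_endInvariants A hss κ γ)

/-! ## §3. The layer-1 count of the residual certificate is a 2-descent count -/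

/-- **`#{s ∈ Sel⁺(A/ℚ_∞) : 2s = 0, (conj_γ − 1)s = 0} = #Sel_{2^∞}(A/ℚ)[2]`** for `A/ℚ` globally minimal, good supersingular at `2`
with `a₂(A) = 0`, `2 ∤ ∏ c_ℓ(A)` and `Sel_{2^∞}(A/ℚ)` finite (cyclotomic `κ`, topological generator `γ`): `h_0` is an injective
homomorphism `Sel_{2^∞}(A/ℚ) → (Sel⁺_∞)^γ` between finite groups of the same order (§2), hence bijective, hence bijective on the
`2`-torsion. So the `a = 1` count of `LayerDual.isTorsion_and_mu_eq_zero_of_card_fixed_lt` is computable by `2`-descent over `ℚ`.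
[cite: Kobayashi2003, Thm. 9.3] [cite: GreenbergLNM1716, §4 Lemma 4.3] -/
theorem natCard_fixed_twoTorsion_eq_natCard_selmer_twoTorsion (hss : GoodSS A 2) (ha : A.frobeniusTrace 2 = 0)
    {κ : ZpExtension ℚ 2} (hκ : κ.IsCyclotomic) {γ : Field.absoluteGaloisGroup ℚ} (hγ : κ.IsTopGenerator γ)
    (hfin : Finite (A.selmerGroupPInfty 2)) (hTam : ¬ 2 ∣ A.tamagawaProduct) :
    Nat.card {s : signedSelmerInfty A κ 1 // 2 • s = 0 ∧ (conjSignedSelmerInfty A κ 1 γ - 1) s = 0} =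
      Nat.card {c : A.selmerGroupPInfty 2 // 2 • c = 0} := by
  obtain ⟨e⟩ := A.nonempty_selmerLayer_zero_addEquiv κ (p := 2)
  obtain ⟨hfinI, -⟩ := natCard_endInvariants_dvd A hss ha hκ hγ hfin
  haveI := hfinI
  haveI := hfin
  have hcard := natCard_endInvariants_eq_natCard_selmer A hss ha hκ hγ hfin hTam
  -- the homomorphism `Sel_{2^∞}(A/ℚ) → (Sel⁺_∞)^γ`
  have hmem : ∀ y : A.selmerLayer κ 0,
      A.layerToInfty κ 0 (y : A.subgroupH1 2 (κ.layerSubgroup 0)) ∈ signedSelmerInfty A κ 1 := fun y ↦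
    SignedEC.selmerLayer_zero_le_comap_layerToInfty_signedSelmerInfty A κ 1 y.2
  have hfix : ∀ y : A.selmerLayer κ 0,
      (⟨A.layerToInfty κ 0 (y : A.subgroupH1 2 (κ.layerSubgroup 0)), hmem y⟩ : signedSelmerInfty A κ 1) ∈
        endInvariants (conjSignedSelmerInfty A κ 1 γ - 1) := by
    intro y
    have hinv : A.layerToInfty κ 0 (y : A.subgroupH1 2 (κ.layerSubgroup 0)) ∈ A.layerInvariants κ 0 :=
      A.range_layerToInfty_le_layerInvariants_holds κ 0 ⟨_, rfl⟩
    exact (SignedEC.mem_endInvariants_conjSignedSelmerInfty_iff A κ 1 γ ⟨_, hmem y⟩).mpr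
      (A.conjH1_eq_of_mem_layerInvariants_zero κ γ hinv)
  let φ : A.selmerLayer κ 0 →+ endInvariants (conjSignedSelmerInfty A κ 1 γ - 1) :=
    { toFun := fun y ↦ ⟨⟨A.layerToInfty κ 0 (y : A.subgroupH1 2 (κ.layerSubgroup 0)), hmem y⟩, hfix y⟩
      map_zero' := by
        apply Subtype.ext; apply Subtype.ext
        change A.layerToInfty κ 0 ((0 : A.selmerLayer κ 0) : A.subgroupH1 2 (κ.layerSubgroup 0)) = 0
        rw [ZeroMemClass.coe_zero, map_zero]
      map_add' := fun x y ↦ by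
        apply Subtype.ext; apply Subtype.ext
        change A.layerToInfty κ 0 ((x + y : A.selmerLayer κ 0) : A.subgroupH1 2 (κ.layerSubgroup 0)) =
          A.layerToInfty κ 0 (x : A.subgroupH1 2 (κ.layerSubgroup 0)) +
            A.layerToInfty κ 0 (y : A.subgroupH1 2 (κ.layerSubgroup 0))
        rw [AddSubgroup.coe_add, map_add] }
  have hφinj : Function.Injective φ := by
    intro x y h
    have h1 : A.layerToInfty κ 0 (x : A.subgroupH1 2 (κ.layerSubgroup 0)) =
        A.layerToInfty κ 0 (y : A.subgroupH1 2 (κ.layerSubgroup 0)) :=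
      congrArg (fun s : endInvariants (conjSignedSelmerInfty A κ 1 γ - 1) ↦
        ((s.1 : signedSelmerInfty A κ 1) : A.subgroupH1 2 κ.kerSubgroup)) h
    exact Subtype.ext (layerToInfty_zero_injective A hss κ h1)
  -- `φ ∘ e⁻¹` is a bijection between finite groups of equal order
  let ψ : A.selmerGroupPInfty 2 →+ endInvariants (conjSignedSelmerInfty A κ 1 γ - 1) := φ.comp e.symm.toAddMonoidHom
  have hψinj : Function.Injective ψ := hφinj.comp e.symm.injective
  have hψbij : Function.Bijective ψ := by
    refine (Nat.bijective_iff_injective_and_card ψ).mpr ⟨hψinj, hcard.symm⟩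
  let Ψ : A.selmerGroupPInfty 2 ≃+ endInvariants (conjSignedSelmerInfty A κ 1 γ - 1) := AddEquiv.ofBijective ψ hψbij
  -- `2`-torsion corresponds under `Ψ`, and the target `2`-torsion is the layer-1 count
  have h1 : Nat.card {c : A.selmerGroupPInfty 2 // 2 • c = 0} =
      Nat.card {t : endInvariants (conjSignedSelmerInfty A κ 1 γ - 1) // 2 • t = 0} := by
    refine Nat.card_congr ⟨fun c ↦ ⟨Ψ c.1, by rw [← map_nsmul, c.2, map_zero]⟩,
      fun t ↦ ⟨Ψ.symm t.1, by rw [← map_nsmul, t.2, map_zero]⟩, fun c ↦ ?_, fun t ↦ ?_⟩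
    · apply Subtype.ext; exact Ψ.symm_apply_apply c.1
    · apply Subtype.ext; exact Ψ.apply_symm_apply t.1
  rw [h1]
  refine Nat.card_congr ⟨fun s ↦ ⟨⟨s.1, (mem_endInvariants_iff _ _).mpr s.2.2⟩, by
      apply Subtype.ext; exact s.2.1⟩,
    fun t ↦ ⟨(t.1 : signedSelmerInfty A κ 1), ⟨by
      have := congrArg (fun u : endInvariants (conjSignedSelmerInfty A κ 1 γ - 1) ↦ (u : signedSelmerInfty A κ 1)) t.2
      exact this, (mem_endInvariants_iff _ _).mp t.1.2⟩⟩, fun s ↦ rfl, fun t ↦ rfl⟩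

end Summit.BirchSwinnertonDyer.BirchSwinnertonDyer.Theorems.SignedMuAtTwo.LayerZero

end
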